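import Summits.ResolutionOfSingularities.ResolutionOfSingularities.Theorems.WeightedInvariantHypersurfaceCentreAssemblyStalkDict
import Summits.ResolutionOfSingularities.ResolutionOfSingularities.Theorems.WeightedInvariantHypersurfaceCentreAssemblyRegular
import Literature.AlgebraicGeometry.Resolution.CotangentIndependenceSpread
import HarnessLib

/-!
# Door assembly H2c″, stub [S4] — the bridge: a model presentation along the maximum locus is a weighted chart on `Y`

Route `ResolutionOfSingularities/WeightedInvariant`, crux `Theses.WeightedInvariant.HypersurfaceCentreConstruction`
(stmt-ResolutionOfSingularities-19897), door line `local-engine`, registered skeleton v3 (793674497624550e), stub [S4]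
`stub_isRegularWeightedCentre_of_isCanonicalCentre` (res-L1-w43-stub-9 = res-D-brk-1). With p502377 ([S4] core:
`isRegularWeightedCentre_of_isCanonicalCentre_of_charts`) the stub reduces to producing, at every point `y` of the maximum
locus, an affine chart `(V, u, w)` of `Y` presenting the pieces of the canonical centre with `u` independent at `y`. This file
proves that the OUTPUT of the ∀-model open-presentation clause (TP5′, `JOpenPresentationForall`, eft4) at the finite-type model
`(A, 𝔮_y, F) = (Γ(Y, U₀), prime of y, a generator of X(U₀))` IS such a chart: `exists_chart_of_presentation`. Ingredients: the
model ↔ stalk dictionary (p503684: `iotaAt_eq_iota_localization`, `J_localGenerator_eq_map_germ_of_presentation`, `stalkEquiv`),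
equality of ideals of sections from equality in all stalks (res-type-025 `ideal_eq_of_forall_map_germ_eq`), transport of cotangent
independence along `stalkEquiv` (p498062 `linearIndependent_toCotangent_map_ringEquiv`). Def-free helper
(`--supports stmt-ResolutionOfSingularities-19897`); no claim about Hironaka's problem.
-/

noncomputable section

set_option linter.dupNamespace false -- mandated namespace of this single-conjunct summit

open CategoryTheory AlgebraicGeometry TopologicalSpace IsLocalRing
open Literature.AlgebraicGeometry.Resolution
open Summit.ResolutionOfSingularities.ResolutionOfSingularities.Theorems

namespace Summit.ResolutionOfSingularities.ResolutionOfSingularities.Cruxes.HypersurfaceCentreConstruction.LocalEngine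

variable (ι : (R : Type) → [CommRing R] → R → Ordinal.{0}) (J : (R : Type) → [CommRing R] → R → ℕ → Ideal R)

/-- With a unit among the positively weighted parameters, the weighted monomial ideal is the unit ideal. [folklore] -/
theorem weightedMonomialIdeal_eq_top_of_isUnit {A : Type*} [CommRing A] {m : ℕ} (u : Fin m → A) (w : Fin m → ℕ)
    {i : Fin m} (hw : 0 < w i) (hu : IsUnit (u i)) (n : ℕ) : weightedMonomialIdeal u w n = ⊤ := by
  refine Ideal.eq_top_of_isUnit_mem _ ?_ (hu.pow n)
  exact weightedMonomialIdeal_antitone u w (Nat.le_mul_of_pos_left n hw)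
    (pow_mem_weightedMonomialIdeal u w (self_mem_weightedMonomialIdeal u w i) n)

/-- **[S4] bridge: a presentation of the canonical filtration along the maximum locus, on a basic open of an affine chart of
`Y`, is a weighted chart of the canonical centre at the point.** Data: `Y → Spec k` smooth (`k` perfect); `R` a canonical centre
of `(Y, X)`; `y ∈ U₀` affine with `X(U₀) = (F)`; `h ∈ Γ(Y, U₀)` with `y ∈ D(h)`; sections `U : Fin N → Γ(Y, U₀)` with positive
weights `W`, vanishing at `y` with linearly independent differentials in `𝒪_{Y,y}`; on `D(h)`: the `Uᵢ` all vanish at `y'` iff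
`y'` lies on the maximum locus (STRATUM EXACTNESS), and at such `y'` the model filtration `J(Γ(Y,U₀)_{𝔮_{y'}}, F/1)` is presented
by `(U, W)` (PRESENTATION). Then `D(h)` with `U|_{D(h)}`, `W` is a chart as `isRegularWeightedCentre_of_isCanonicalCentre_of_charts`
wants. [cite: Wlodarczyk2022, 2.1.10] -/
theorem exists_chart_of_presentation {k : Type} [Field k] {Y : Scheme.{0}} (f : Y ⟶ Spec (.of k)) [Smooth f]
    (hJ : JIsoInvariant J) (hJu : JUnitInvariant J) {X : Y.IdealSheafData} {R : ReesAlgebraData Y}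
    (hR : IsCanonicalCentre ι J X R) (U₀ : Y.affineOpens) {y : Y} (hy : y ∈ (U₀ : Y.Opens)) {F : Γ(Y, U₀)}
    (hF : X.ideal U₀ = Ideal.span {F}) (h : Γ(Y, U₀)) (hyh : y ∈ Y.basicOpen h) {N : ℕ} (U : Fin N → Γ(Y, U₀))
    (W : Fin N → ℕ) (hW : ∀ i, 0 < W i)
    (hUy : ∀ i, (Y.presheaf.germ (U₀ : Y.Opens) y hy).hom (U i) ∈ maximalIdeal (Y.presheaf.stalk y))
    (hli : LinearIndependent (ResidueField (Y.presheaf.stalk y))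
      fun i => (maximalIdeal (Y.presheaf.stalk y)).toCotangent ⟨_, hUy i⟩)
    (hstrat : ∀ (y' : Y) (hy' : y' ∈ (U₀ : Y.Opens)), y' ∈ Y.basicOpen h →
      ((∀ i, (Y.presheaf.germ (U₀ : Y.Opens) y' hy').hom (U i) ∈ maximalIdeal (Y.presheaf.stalk y')) ↔ y' ∈ maxLocus ι X))
    (hpres : ∀ (y' : Y) (hy' : y' ∈ (U₀ : Y.Opens)), y' ∈ Y.basicOpen h → y' ∈ maxLocus ι X → ∀ m : ℕ,
      J (Localization.AtPrime (U₀.2.primeIdealOf ⟨y', hy'⟩).asIdeal)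
          (algebraMap Γ(Y, U₀) (Localization.AtPrime (U₀.2.primeIdealOf ⟨y', hy'⟩).asIdeal) F) m =
        (weightedMonomialIdeal U W m).map (algebraMap Γ(Y, U₀) (Localization.AtPrime (U₀.2.primeIdealOf ⟨y', hy'⟩).asIdeal))) :
    ∃ (V : Y.affineOpens) (hyV : y ∈ (V : Y.Opens)) (m : ℕ) (u : Fin m → Γ(Y, V)) (w : Fin m → ℕ),
      (∀ i, 0 < w i) ∧ (∀ n, (R.piece n).ideal V = weightedMonomialIdeal u w n) ∧
      ∃ hu : ∀ i, (Y.presheaf.germ (V : Y.Opens) y hyV).hom (u i) ∈ maximalIdeal (Y.presheaf.stalk y),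
        LinearIndependent (ResidueField (Y.presheaf.stalk y))
          fun i => (maximalIdeal (Y.presheaf.stalk y)).toCotangent ⟨_, hu i⟩ := by
  -- the chart `V = D(h) ⊆ U₀`, parameters `U|_V`
  let V : Y.affineOpens := ⟨Y.basicOpen h, U₀.2.basicOpen h⟩
  have hVU : (V : Y.Opens) ≤ U₀ := Y.basicOpen_le h
  let u : Fin N → Γ(Y, V) := fun i => (Y.presheaf.map (homOfLE hVU).op).hom (U i)
  have hgerm : ∀ (y' : Y) (hy' : y' ∈ (V : Y.Opens)) (i : Fin N),
      (Y.presheaf.germ (V : Y.Opens) y' hy').hom (u i) = (Y.presheaf.germ (U₀ : Y.Opens) y' (hVU hy')).hom (U i) :=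
    fun y' hy' i => TopCat.Presheaf.germ_res_apply Y.presheaf (homOfLE hVU) y' hy' (U i)
  refine ⟨V, hyh, N, u, W, hW, fun n => ?_, ?_⟩
  · -- the pieces over `V`: equal to the weighted monomial ideals in every stalk
    refine ideal_eq_of_forall_map_germ_eq V fun y' hy' => ?_
    have hy'U : y' ∈ (U₀ : Y.Opens) := hVU hy'
    rw [← stalkIdeal_eq_map_germ (R.piece n) V hy', weightedMonomialIdeal_map]
    -- germs along `V ≤ U₀`
    have hu' : (fun i => (Y.presheaf.germ (V : Y.Opens) y' hy').hom (u i)) =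
        fun i => (Y.presheaf.germ (U₀ : Y.Opens) y' hy'U).hom (U i) := funext fun i => hgerm y' hy' i
    rw [hu', ← weightedMonomialIdeal_map]
    by_cases hy'M : y' ∈ maxLocus ι X
    · -- on the maximum locus: the canonical stalk filtration, presented by `(U, W)` on the model
      rw [hR.stalkIdeal_eq y' hy'M n]
      exact J_localGenerator_eq_map_germ_of_presentation J (hy := hy'U) f hJ hJu X hF (hpres y' hy'U hy' hy'M n)
    · -- off the maximum locus: both sides are the unit ideal
      rw [hR.stalkIdeal_eq_top y' hy'M n]
      obtain ⟨i, hi⟩ : ∃ i, (Y.presheaf.germ (U₀ : Y.Opens) y' hy'U).hom (U i) ∉ maximalIdeal (Y.presheaf.stalk y') := by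
        by_contra hall
        push Not at hall
        exact hy'M ((hstrat y' hy'U hy').mp hall)
      rw [weightedMonomialIdeal_map]
      exact (weightedMonomialIdeal_eq_top_of_isUnit _ W (hW i) (IsLocalRing.notMem_maximalIdeal.mp hi) n).symm
  · -- independence at `y`, read on the restricted sections
    have hu : ∀ i, (Y.presheaf.germ (V : Y.Opens) y hyh).hom (u i) ∈ maximalIdeal (Y.presheaf.stalk y) := fun i => by
      rw [hgerm y hyh i]; exact hUy i
    refine ⟨hu, ?_⟩
    convert hli using 3 with i
    exact Subtype.ext (hgerm y hyh i)

end Summit.ResolutionOfSingularities.ResolutionOfSingularities.Cruxes.HypersurfaceCentreConstruction.LocalEngine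

end
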